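import Summits.Langlands.Langlands.Theses.RootDecomp1
import Summits.Langlands.Langlands.Theses.CyclicLayerPeeling

/-! BC3 birth skeleton for `AnabelianLayerDescent` (node `CyclicLayerPeeling`, lens-4 g23; DECLARED RESIDUAL).  PRE-BIRTH form (text verbatim below); after birth swap the def for the route decl
`Summit.Langlands.Langlands.Theses.CyclicLayerPeeling.AnabelianLayerDescent` and publish as `Cruxes/AnabelianLayerDescent/Lines/birth.lean`.  Two registered stubs = the two shapes of a peel-free layer: `stub_perfectGaloisLayer` (M/K GALOIS
and peel-free ⟹ Gal(M/K) has no cyclic quotient of prime order, i.e. is PERFECT (or trivial): A₅, PSL₂(𝔽_q), … — the (A)-side shadow of non-solvable base change;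
dark, BARRIER-adjacent to `SolvableImageBarrier`'s moral) and `stub_nonNormalLayer` (M/K NOT Galois, M ∩ K^ab = K: non-Galois cubics, A₄/S₄-quartics, primitive
fields — first ATTACKABLE-mod-CPD sub-box when the Galois closure is solvable: base-change P up the closure and peel; the up-move is not in the node).  The
composition is excluded middle on `IsGalois K M`. -/

set_option linter.dupNamespace false
set_option linter.unusedVariables false

open scoped BigOperators Topology Manifold Classical MeasureTheory ProbabilityTheory Matrix InnerProductSpace ComplexConjugate ContinuousMap
open Filter Set Function TopologicalSpace MeasureTheory

namespace Summit.Langlands.Langlands.Cruxes.AnabelianLayerDescent.Birth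

-- POST-BIRTH form: the local restated `def AnabelianLayerDescent` of the pre-birth kit is removed; stubs unchanged; ONE closed theorem `AnabelianLayerDescent_proof` concludes the ROUTE DECL by name.

/-- stub A1 · PERFECT GALOIS LAYER (hardest; dark core): M/K Galois, not cyclic-prime, no strict cyclic-prime bottom layer. -/
theorem stub_perfectGaloisLayer :
    ∀ (K : Type) [Field K] [NumberField K] (n : ℕ) (hcpt : Literature.NumberTheory.Automorphic.isCompact_glFiniteIntegralLevel n K), 0 < n → ∀ (π : Literature.NumberTheory.Automorphic.CuspidalAutomorphicRepData n K hcpt), π.1.IsLAlgebraic → ∀ (M : Type) [Field M] [NumberField M] [Algebra K M], ¬ (IsGalois K M ∧ IsCyclic (M ≃ₐ[K] M) ∧ (Module.finrank K M).Prime) → (¬ ∃ F : IntermediateField K M, F ≠ ⊥ ∧ F ≠ ⊤ ∧ IsGalois K ↥F ∧ IsCyclic (↥F ≃ₐ[K] ↥F) ∧ (Module.finrank K ↥F).Prime) → IsGalois K M → ∀ (hM : Literature.NumberTheory.Automorphic.isCompact_glFiniteIntegralLevel n M) (P : Literature.NumberTheory.Automorphic.CuspidalAutomorphicRepData n M hM),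 P.1.IsLAlgebraic → Literature.NumberTheory.Automorphic.IsWeakBaseChangeLiftAE π.1 P.1 → ∀ (ℓ : ℕ) [Fact ℓ.Prime] (ι : PadicAlgCl ℓ ≃+* ℂ) (r : Literature.NumberTheory.GaloisRepresentations.FramedGaloisRep M (PadicAlgCl ℓ) n), r.toGaloisRep.IsSemisimple → (∀ᶠ w : IsDedekindDomain.HeightOneSpectrum (NumberField.RingOfIntegers M) in cofinite, SatakeFrobCompatibleAt ι P.1 r w) → ∃ ρ : Literature.NumberTheory.GaloisRepresentations.FramedGaloisRep K (PadicAlgCl ℓ) n, ρ.toGaloisRep.IsSemisimple ∧ ∀ᶠ v : IsDedekindDomain.HeightOneSpectrum (NumberField.RingOfIntegers K) in cofinite, SatakeFrobCompatibleAt ι π.1 ρ v := by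
  sorry

/-- stub A2 · NON-NORMAL PEEL-FREE LAYER: M/K not Galois, no strict cyclic-prime bottom layer (solvable-closure part attackable mod CPD by the up-move). -/
theorem stub_nonNormalLayer :
    ∀ (K : Type) [Field K] [NumberField K] (n : ℕ) (hcpt : Literature.NumberTheory.Automorphic.isCompact_glFiniteIntegralLevel n K), 0 < n → ∀ (π : Literature.NumberTheory.Automorphic.CuspidalAutomorphicRepData n K hcpt), π.1.IsLAlgebraic → ∀ (M : Type) [Field M] [NumberField M] [Algebra K M], ¬ (IsGalois K M ∧ IsCyclic (M ≃ₐ[K] M) ∧ (Module.finrank K M).Prime) → (¬ ∃ F : IntermediateField K M, F ≠ ⊥ ∧ F ≠ ⊤ ∧ IsGalois K ↥F ∧ IsCyclic (↥F ≃ₐ[K] ↥F) ∧ (Module.finrank K ↥F).Prime) → ¬ IsGalois K M → ∀ (hM : Literature.NumberTheory.Automorphic.isCompact_glFiniteIntegralLevel n M) (P : Literature.NumberTheory.Automorphic.CuspidalAutomorphicRepData n M hM), P.1.IsLAlgebraic → Literature.NumberTheory.Automorphic.IsWeakBaseChangeLiftAE π.1 P.1 → ∀ (ℓ : ℕ) [Fact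 ℓ.Prime] (ι : PadicAlgCl ℓ ≃+* ℂ) (r : Literature.NumberTheory.GaloisRepresentations.FramedGaloisRep M (PadicAlgCl ℓ) n), r.toGaloisRep.IsSemisimple → (∀ᶠ w : IsDedekindDomain.HeightOneSpectrum (NumberField.RingOfIntegers M) in cofinite, SatakeFrobCompatibleAt ι P.1 r w) → ∃ ρ : Literature.NumberTheory.GaloisRepresentations.FramedGaloisRep K (PadicAlgCl ℓ) n, ρ.toGaloisRep.IsSemisimple ∧ ∀ᶠ v : IsDedekindDomain.HeightOneSpectrum (NumberField.RingOfIntegers K) in cofinite, SatakeFrobCompatibleAt ι π.1 ρ v := by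
  sorry

/-- CLOSED COMPOSITION (post-birth shape, writer-1 WORD (A)(61)): the route decl `Summit.Langlands.Langlands.Theses.CyclicLayerPeeling.AnabelianLayerDescent` from the registered stubs. -/
theorem AnabelianLayerDescent_proof :
    Summit.Langlands.Langlands.Theses.CyclicLayerPeeling.AnabelianLayerDescent := by
  have h1 := stub_perfectGaloisLayer
  have h2 := stub_nonNormalLayer
  intro K _ _ n hcpt hn π hπ M _ _ _ hcyc hex hM P hP hBC ℓ _ ι r hr hrc
  by_cases hG : IsGalois K M
  · exact h1 K n hcpt hn π hπ M hcyc hex hG hM P hP hBC ℓ ι r hr hrc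
  · exact h2 K n hcpt hn π hπ M hcyc hex hG hM P hP hBC ℓ ι r hr hrc

end Summit.Langlands.Langlands.Cruxes.AnabelianLayerDescent.Birth
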